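import Summits.SmoothPoincare4.SmoothPoincare4.Theses.CongruenceShadows

/-!
# `WaldhausenPairs` — negative-side support (1): load-bearing hypotheses

Refuter negative lemmas (cdisprove seat) for crux item stmt-SmoothPoincare4-14592
(`CongruenceShadows.WaldhausenPairs`: for every balanced `(3+3m, m+1)` group trisection `K` of
the trivial group and every `i ≠ j`, ONE automorphism of `S_{3+3m}` carries the standard pair
`(N_i, N_j)` (`N = s4Kernels.stabilizeIter m`) onto `(K_i, K_j)`).

* §0 a small API for kernels generated by standard generators of `S_g` (`genKernel`), rank
  counts of their quotients, and rank invariance of finitely generated free groups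
  (`freeGroup_rank_eq`, by counting homomorphisms to `ℤ/2`).
* §0' NON-VACUITY: `stabilizeIter_isGroupTrisection` — the hypothesis is inhabited at every `m`
  by `K = N`, where the conclusion holds with `α = 1` (`conclusion_at_standard`).
* §A LOAD-BEARING ANALYSIS: `waldhausenPairs_false_without_pairFree` — with the field
  `free_pairQuotient` of `IsGroupTrisection` dropped the statement is FALSE (`m = 0`,
  `K = (⟪a₁,a₂,a₃⟫, ⟪a₁,a₂,a₃⟫, ⟪b₁,b₂,b₃⟫)`, as `N₀ ≠ N₁`);
  `waldhausenPairs_false_without_freeQuotient` — with `free_quotient` dropped it is FALSE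
  (`m = 0`, `Kᵢ = ⟪a₁,a₂,a₃,bᵢ⟫`: pair quotients `F₁`, triple trivial, `S/K₀ ≅ F₂ ≄ F₃`).
  So every proof must use both the pairwise pushout (the 3-manifold `Hᵢ ∪ Hⱼ`, Waldhausen) and
  the exact rank `g` of the single quotients (Leininger–Reid 2002, Lemma 2.2). The fields
  `triple` and `free_quotient l`, `l ∉ {i, j}`, are never used (see the crux work file
  `Cruxes/WaldhausenPairs/Disproof.lean`, §C).
-/

-- the prescribed namespace `Summit.<P>.<Sub>.…` duplicates `SmoothPoincare4` (P = Sub)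
set_option linter.dupNamespace false

noncomputable section

namespace Summit.SmoothPoincare4.SmoothPoincare4.Theorems.WaldhausenPairs.Negative

open Literature.Topology.FourManifolds Subgroup

/-! ## §0 Generator kernels in `S_g` (small API over `GroupTrisections.lean`) -/

variable {g : ℕ}

/-- The normal closure of a set of standard generators of `S_g`. [folklore] -/
def genKernel (S : Finset (surfaceGen g)) : Subgroup (SurfaceGroup g) :=
  normalClosure (PresentedGroup.of '' (S : Set (surfaceGen g)))

/-- Generator kernels are normal (they are normal closures). [folklore] -/
instance genKernel_normal (S : Finset (surfaceGen g)) : (genKernel S).Normal := by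
  unfold genKernel; infer_instance

/-- The generators in `S` lie in `genKernel S`. [folklore] -/
theorem of_mem_genKernel {S : Finset (surfaceGen g)} {x : surfaceGen g} (hx : x ∈ S) :
    (PresentedGroup.of x : SurfaceGroup g) ∈ genKernel S :=
  subset_normalClosure ⟨x, hx, rfl⟩

/-- A generator kernel dies under erasing any larger handle-meeting set. [folklore] -/
theorem genKernel_le_ker (S T : Finset (surfaceGen g))
    (hT : ∀ i : Fin g, (i, false) ∈ T ∨ (i, true) ∈ T) (h : S ⊆ T) :
    genKernel S ≤ (eraseHom T hT).ker := by
  refine normalClosure_le_normal ?_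
  rintro _ ⟨x, hx, rfl⟩
  exact of_mem_ker_eraseHom T hT (h hx)

/-- A surviving generator is not in the generator kernel. [folklore] -/
theorem of_not_mem_genKernel {S : Finset (surfaceGen g)}
    (hS : ∀ i : Fin g, (i, false) ∈ S ∨ (i, true) ∈ S) {x : surfaceGen g} (hx : x ∉ S) :
    (PresentedGroup.of x : SurfaceGroup g) ∉ genKernel S := by
  intro h
  have h1 := genKernel_le_ker S S hS le_rfl h
  rw [MonoidHom.mem_ker, eraseHom_of, eraseGen_of_not_mem hx] at h1
  exact FreeGroup.of_ne_one _ h1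

/-- `S_g ⧸ ⟪generators in S⟫` is free on the survivors (rank count). [folklore] -/
theorem isFreeOfRank_quot_genKernel (S : Finset (surfaceGen g))
    (hS : ∀ i : Fin g, (i, false) ∈ S ∨ (i, true) ∈ S) {n : ℕ}
    (hn : Fintype.card {x // x ∉ S} = n) :
    IsFreeOfRank (SurfaceGroup g ⧸ normalClosure ((genKernel S : Subgroup (SurfaceGroup g)) :
      Set (SurfaceGroup g))) n := by
  refine isFreeOfRank_quotient_of_erase S hS _ (fun x hx => ?_) ?_ hn
  · exact subset_normalClosure (of_mem_genKernel hx)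
  · exact normalClosure_le_normal (genKernel_le_ker S S hS le_rfl)

/-- The pair quotient of two generator kernels is free on the common survivors. [folklore] -/
theorem isFreeOfRank_quot_genKernel_pair (S T : Finset (surfaceGen g))
    (hS : ∀ i : Fin g, (i, false) ∈ S ∨ (i, true) ∈ S) {n : ℕ}
    (hn : Fintype.card {x // x ∉ S ∪ T} = n) :
    IsFreeOfRank (SurfaceGroup g ⧸ normalClosure (((genKernel S : Subgroup (SurfaceGroup g)) :
      Set (SurfaceGroup g)) ∪ (genKernel T : Subgroup (SurfaceGroup g)))) n := by
  have hST : ∀ i : Fin g, (i, false) ∈ S ∪ T ∨ (i, true) ∈ S ∪ T :=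
    fun i => (hS i).imp (Finset.mem_union_left _) (Finset.mem_union_left _)
  refine isFreeOfRank_quotient_of_erase (S ∪ T) hST _ (fun x hx => ?_) ?_ hn
  · rw [Finset.mem_union] at hx
    rcases hx with hx | hx
    · exact subset_normalClosure (Or.inl (of_mem_genKernel hx))
    · exact subset_normalClosure (Or.inr (of_mem_genKernel hx))
  · exact normalClosure_le_normal (Set.union_subset
      (genKernel_le_ker S _ hST Finset.subset_union_left)
      (genKernel_le_ker T _ hST Finset.subset_union_right))

/-- If the generator sets of a kernel triple cover all generators, the triple quotient is
trivial. [folklore] -/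
theorem tripleQuotient_trivial (S : Fin 3 → Finset (surfaceGen g))
    (hcover : ∀ x : surfaceGen g, ∃ i, x ∈ S i) :
    Nonempty (TrisectionKernels.tripleQuotient (fun i => genKernel (S i)) ≃* (PUnit : Type)) := by
  have hU : ∀ k : Fin g, (k, false) ∈ (Finset.univ : Finset (surfaceGen g)) ∨
      (k, true) ∈ (Finset.univ : Finset (surfaceGen g)) := fun k => Or.inl (Finset.mem_univ _)
  haveI : IsEmpty {x : surfaceGen g // x ∉ (Finset.univ : Finset (surfaceGen g))} :=
    ⟨fun x => x.2 (Finset.mem_univ _)⟩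
  refine ⟨(quotientEquivFreeGroupErase Finset.univ hU _ ?_ ?_).trans MulEquiv.ofUnique⟩
  · intro x _
    obtain ⟨i, hi⟩ := hcover x
    exact subset_normalClosure (Set.mem_iUnion.2 ⟨i, of_mem_genKernel hi⟩)
  · refine normalClosure_le_normal (Set.iUnion_subset fun i => ?_)
    exact genKernel_le_ker (S i) _ hU (Finset.subset_univ _)

/-! ## §0' The standard triple at every genus: non-vacuity -/

/-- The hypothesis of the crux is inhabited at every `m`: `N = s4Kernels.stabilizeIter m` is a
`(3+3m, m+1)` group trisection of the trivial group (induction on the two discharged named facts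
of `GroupTrisections.lean`). [cite: AbramsGayKirby2018, Def. 3] -/
theorem stabilizeIter_isGroupTrisection (m : ℕ) :
    IsGroupTrisection (3 + 3 * m) (m + 1) (PUnit : Type) (s4Kernels.stabilizeIter m) := by
  induction m with
  | zero => exact s4Kernels_isGroupTrisection_holds
  | succ m ih => exact stabilize_isGroupTrisection_holds _ _ _ _ ih

/-- At `K = N` the conclusion holds with `α = 1` (so the conclusion is satisfiable and the
statement is not refutable by its standard model). [folklore] -/
theorem conclusion_at_standard (m : ℕ) (i j : Fin 3) :
    ∃ α : SurfaceGroup (3 + 3 * m) ≃* SurfaceGroup (3 + 3 * m),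
      (s4Kernels.stabilizeIter m i).map α.toMonoidHom = s4Kernels.stabilizeIter m i ∧
      (s4Kernels.stabilizeIter m j).map α.toMonoidHom = s4Kernels.stabilizeIter m j :=
  ⟨MulEquiv.refl _, by simp, by simp⟩

/-! ## §0'' Genus 3 (`m = 0`): the standard kernels are pairwise distinct -/

/-- `s4Kernels i` is the generator kernel of `s4Gens i`. [folklore] -/
theorem s4Kernels_eq_genKernel (i : Fin 3) : s4Kernels i = genKernel (s4Gens i) :=
  s4Kernels_eq i

/-- `b₂ ∈ N₁ = ⟪a₁,b₂,a₃⟫` but `b₂ ∉ N₀ = ⟪a₁,a₂,b₃⟫`; hence `N₀ ≠ N₁`. [folklore] -/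
theorem s4Kernels_zero_ne_one : s4Kernels 0 ≠ s4Kernels 1 := by
  intro h
  have hb : (PresentedGroup.of ((1 : Fin 3), true) : SurfaceGroup 3) ∈ s4Kernels 1 :=
    of_mem_s4Kernels 1 (by decide)
  rw [← h, s4Kernels_eq_genKernel] at hb
  exact of_not_mem_genKernel (s4Gens_hits 0) (by decide) hb

/-! ## §0''' Rank of a finitely generated free group is an isomorphism invariant -/

/-- `F_m ≅ F_n → m = n`, by counting homomorphisms to `ℤ/2`. [folklore] -/
theorem freeGroup_rank_eq {m n : ℕ} (e : FreeGroup (Fin m) ≃* FreeGroup (Fin n)) : m = n := by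
  have key : (Fin m → Multiplicative (ZMod 2)) ≃ (Fin n → Multiplicative (ZMod 2)) :=
    FreeGroup.lift.trans ((MulEquiv.monoidHomCongrLeftEquiv e).trans FreeGroup.lift.symm)
  have h := Fintype.card_congr key
  simp only [Fintype.card_fun, Fintype.card_fin, Fintype.card_multiplicative, ZMod.card] at h
  exact Nat.pow_right_injective le_rfl h

/-- The rank in `IsFreeOfRank` is well defined. [folklore] -/
theorem IsFreeOfRank.rank_eq {H : Type*} [Group H] {m n : ℕ} (hm : IsFreeOfRank H m)
    (hn : IsFreeOfRank H n) : m = n := by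
  obtain ⟨em⟩ := hm
  obtain ⟨en⟩ := hn
  exact freeGroup_rank_eq (em.trans en.symm)

/-! ## §A Load-bearing hypotheses (`_false_without_`) — genus 3, `m = 0` witnesses -/

/-- `{a₁, a₂, a₃}`. [folklore] -/
def aGens : Finset (surfaceGen 3) := {((0 : Fin 3), false), ((1 : Fin 3), false), ((2 : Fin 3), false)}

/-- `{b₁, b₂, b₃}`. [folklore] -/
def bGens : Finset (surfaceGen 3) := {((0 : Fin 3), true), ((1 : Fin 3), true), ((2 : Fin 3), true)}

/-- `{a₁, a₂, a₃, bᵢ}`. [folklore] -/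
def abGens (i : Fin 3) : Finset (surfaceGen 3) :=
  {((0 : Fin 3), false), ((1 : Fin 3), false), ((2 : Fin 3), false), (i, true)}

/-- Generator sets of the witness `(⟪a⟫, ⟪a⟫, ⟪b⟫)`. [folklore] -/
def aabGens : Fin 3 → Finset (surfaceGen 3) := ![aGens, aGens, bGens]

/-- `{a₁,a₂,a₃}` meets every handle. [folklore] -/
theorem aGens_hits (k : Fin 3) : (k, false) ∈ aGens ∨ (k, true) ∈ aGens := by
  fin_cases k <;> decide

/-- `{b₁,b₂,b₃}` meets every handle. [folklore] -/
theorem bGens_hits (k : Fin 3) : (k, false) ∈ bGens ∨ (k, true) ∈ bGens := by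
  fin_cases k <;> decide

/-- `{a₁,a₂,a₃,bᵢ}` meets every handle. [folklore] -/
theorem abGens_hits (i k : Fin 3) : (k, false) ∈ abGens i ∨ (k, true) ∈ abGens i := by
  fin_cases i <;> fin_cases k <;> decide

/-- Each generator set of the witness `(⟪a⟫,⟪a⟫,⟪b⟫)` meets every handle. [folklore] -/
theorem aabGens_hits (i k : Fin 3) : (k, false) ∈ aabGens i ∨ (k, true) ∈ aabGens i := by
  fin_cases i <;> fin_cases k <;> decide

/-- The generator sets of `(⟪a⟫,⟪a⟫,⟪b⟫)` cover all generators. [folklore] -/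
theorem aabGens_cover (x : surfaceGen 3) : ∃ i, x ∈ aabGens i := by
  obtain ⟨k, b⟩ := x
  fin_cases k <;> cases b <;> first | exact ⟨0, by decide⟩ | exact ⟨2, by decide⟩

/-- The generator sets `{a₁,a₂,a₃,bᵢ}` cover all generators. [folklore] -/
theorem abGens_cover (x : surfaceGen 3) : ∃ i, x ∈ abGens i := by
  obtain ⟨k, b⟩ := x
  fin_cases k <;> cases b <;> first | exact ⟨0, by decide⟩ | exact ⟨1, by decide⟩ | exact ⟨2, by decide⟩

/-- Three generators survive `{a₁,a₂,a₃}`. [folklore] -/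
theorem card_compl_aGens : Fintype.card {x // x ∉ aGens} = 3 := by decide
/-- Three generators survive `{b₁,b₂,b₃}`. [folklore] -/
theorem card_compl_bGens : Fintype.card {x // x ∉ bGens} = 3 := by decide
/-- Two generators survive `{a₁,a₂,a₃,bᵢ}`. [folklore] -/
theorem card_compl_abGens (i : Fin 3) : Fintype.card {x // x ∉ abGens i} = 2 := by
  fin_cases i <;> decide
/-- One generator survives `{a₁,a₂,a₃,bᵢ,bⱼ}` for `i ≠ j`. [folklore] -/
theorem card_compl_abGens_union (i j : Fin 3) (hij : i ≠ j) :
    Fintype.card {x // x ∉ abGens i ∪ abGens j} = 1 := by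
  fin_cases i <;> fin_cases j <;> first | exact absurd rfl hij | decide

/-- The witness kernel triple `(⟪a₁,a₂,a₃⟫, ⟪a₁,a₂,a₃⟫, ⟪b₁,b₂,b₃⟫)` in `S_3`. [folklore] -/
def witnessAAB : TrisectionKernels 3 := fun i => genKernel (aabGens i)

/-- The witness kernel triple `Kᵢ = ⟪a₁,a₂,a₃,bᵢ⟫` in `S_3`. [folklore] -/
def witnessAB : TrisectionKernels 3 := fun i => genKernel (abGens i)

/-- LOAD-BEARING: without pair-freeness the crux is false. Witness `m = 0`,
`K = (⟪a₁,a₂,a₃⟫, ⟪a₁,a₂,a₃⟫, ⟪b₁,b₂,b₃⟫)`: normal, single quotients `F_3`, triple quotient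
trivial, but `K₀ = K₁` cannot be `(α N₀, α N₁)` since `N₀ ≠ N₁`. (Its pair quotients are `F_3`
and `1`, not `F_1`.) Any proof must use the pairwise pushout, i.e. the 3-manifold `Hᵢ ∪ Hⱼ`.
[folklore] -/
theorem waldhausenPairs_false_without_pairFree :
    ¬ (∀ (m : ℕ) (K : TrisectionKernels (3 + 3 * m)),
      (∀ i, (K i).Normal) →
      (∀ i, IsFreeOfRank (SurfaceGroup (3 + 3 * m) ⧸
        normalClosure (K i : Set (SurfaceGroup (3 + 3 * m)))) (3 + 3 * m)) →
      Nonempty (K.tripleQuotient ≃* (PUnit : Type)) →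
      ∀ i j : Fin 3, i ≠ j → ∃ α : SurfaceGroup (3 + 3 * m) ≃* SurfaceGroup (3 + 3 * m),
        (s4Kernels.stabilizeIter m i).map α.toMonoidHom = K i ∧
        (s4Kernels.stabilizeIter m j).map α.toMonoidHom = K j) := by
  intro h
  have hfree : ∀ i, IsFreeOfRank (SurfaceGroup 3 ⧸
      normalClosure (witnessAAB i : Set (SurfaceGroup 3))) 3 := by
    intro i
    fin_cases i
    · exact isFreeOfRank_quot_genKernel aGens aGens_hits card_compl_aGens
    · exact isFreeOfRank_quot_genKernel aGens aGens_hits card_compl_aGens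
    · exact isFreeOfRank_quot_genKernel bGens bGens_hits card_compl_bGens
  obtain ⟨α, h0, h1⟩ := h 0 witnessAAB (fun i => genKernel_normal _) hfree
    (tripleQuotient_trivial aabGens aabGens_cover) 0 1 (by decide)
  apply s4Kernels_zero_ne_one
  apply Subgroup.map_injective (f := α.toMonoidHom) (by exact α.injective)
  change (s4Kernels.stabilizeIter 0 0).map α.toMonoidHom = (s4Kernels.stabilizeIter 0 1).map α.toMonoidHom
  rw [h0, h1]
  rfl

/-- LOAD-BEARING: without rank-`g` freeness of the single quotients the crux is false.
Witness `m = 0`, `Kᵢ = ⟪a₁,a₂,a₃,bᵢ⟫`: normal, pair quotients `F_1` (one surviving `b`), triple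
quotient trivial, but `S_3/K₀ ≅ F_2 ≄ F_3 ≅ S_3/N₀`, so no automorphism carries `N₀` to `K₀`.
Any proof must use that `S_g/Kᵢ` is free of rank exactly `g` (Leininger–Reid 2002 Lemma 2.2 /
Jaco 1969: epimorphisms `S_g ↠ F_g` are geometric). [folklore] -/
theorem waldhausenPairs_false_without_freeQuotient :
    ¬ (∀ (m : ℕ) (K : TrisectionKernels (3 + 3 * m)),
      (∀ i, (K i).Normal) →
      (∀ i j, i ≠ j → IsFreeOfRank (K.pairQuotient i j) (m + 1)) →
      Nonempty (K.tripleQuotient ≃* (PUnit : Type)) →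
      ∀ i j : Fin 3, i ≠ j → ∃ α : SurfaceGroup (3 + 3 * m) ≃* SurfaceGroup (3 + 3 * m),
        (s4Kernels.stabilizeIter m i).map α.toMonoidHom = K i ∧
        (s4Kernels.stabilizeIter m j).map α.toMonoidHom = K j) := by
  intro h
  have hpair : ∀ i j : Fin 3, i ≠ j → IsFreeOfRank (witnessAB.pairQuotient i j) (0 + 1) :=
    fun i j hij => isFreeOfRank_quot_genKernel_pair (abGens i) (abGens j) (abGens_hits i)
      (card_compl_abGens_union i j hij)
  obtain ⟨α, h0, -⟩ := h 0 witnessAB (fun i => genKernel_normal _) hpair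
    (tripleQuotient_trivial abGens abGens_cover) 0 1 (by decide)
  have h0' : (s4Kernels 0).map (α : SurfaceGroup 3 →* SurfaceGroup 3) = genKernel (abGens 0) := h0
  -- `S_3 / N₀ ≅ S_3 / K₀`, transported to the `normalClosure` forms used by `IsFreeOfRank`
  have e : SurfaceGroup 3 ⧸ normalClosure ((s4Kernels 0 : Subgroup (SurfaceGroup 3)) :
        Set (SurfaceGroup 3)) ≃*
      SurfaceGroup 3 ⧸ normalClosure ((genKernel (abGens 0) : Subgroup (SurfaceGroup 3)) :
        Set (SurfaceGroup 3)) := by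
    haveI : (s4Kernels 0).Normal := s4Kernels_isGroupTrisection_holds.normal 0
    exact ((QuotientGroup.quotientMulEquivOfEq (normalClosure_eq_self _)).trans
      (QuotientGroup.congr (s4Kernels 0) (genKernel (abGens 0)) α h0')).trans
      (QuotientGroup.quotientMulEquivOfEq (normalClosure_eq_self _).symm)
  have h3 : IsFreeOfRank (SurfaceGroup 3 ⧸ normalClosure ((genKernel (abGens 0) :
      Subgroup (SurfaceGroup 3)) : Set (SurfaceGroup 3))) 3 :=
    (s4Kernels_isGroupTrisection_holds.free_quotient 0).of_mulEquiv e
  have h2 : IsFreeOfRank (SurfaceGroup 3 ⧸ normalClosure ((genKernel (abGens 0) :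
      Subgroup (SurfaceGroup 3)) : Set (SurfaceGroup 3))) 2 :=
    isFreeOfRank_quot_genKernel (abGens 0) (abGens_hits 0) (card_compl_abGens 0)
  exact absurd (IsFreeOfRank.rank_eq h3 h2) (by decide)

/-- Corollary: with the whole hypothesis `IsGroupTrisection` dropped the statement is false
(the hypothesis is not decoration). [folklore] -/
theorem waldhausenPairs_false_without_hypothesis :
    ¬ ∀ (m : ℕ) (K : TrisectionKernels (3 + 3 * m)) (i j : Fin 3), i ≠ j →
      ∃ α : SurfaceGroup (3 + 3 * m) ≃* SurfaceGroup (3 + 3 * m),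
        (s4Kernels.stabilizeIter m i).map α.toMonoidHom = K i ∧
        (s4Kernels.stabilizeIter m j).map α.toMonoidHom = K j :=
  fun h => waldhausenPairs_false_without_pairFree fun m K _ _ _ i j hij => h m K i j hij

end Summit.SmoothPoincare4.SmoothPoincare4.Theorems.WaldhausenPairs.Negative

end
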